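import Literature.NumberTheory.EllipticCurves.KuriharaNumberKimShaLength
import Literature.NumberTheory.EllipticCurves.KuriharaNumberInvariants
import HarnessLib

/-!
# Kim's structure theorem, clause (6), AS PRINTED: `length_{ℤ_p} Ш(E/ℚ)[p^∞] = ∂^{(ord(δ̃))}(δ̃) − ∂^{(∞)}(δ̃)`
# for EVERY vanishing order — the rank-agnostic core at `p ≥ 5`, in the `∂`-vocabulary of `KuriharaNumberInvariants`

Topic `NumberTheory/EllipticCurves`; namespace `Literature.NumberTheory.EllipticCurves.Kim2026`. ONE
named fact (`def … : Prop`, D-0014; no `_holds` — the proof is the whole paper: Mazur–Rubin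
Kolyvagin systems, Kato's Euler system and explicit reciprocity law; literature-prover triage size
XL) and its two specialisations PROVED from it (vanishing order `0`, vanishing order `1`). Written
for the residual cell `b2b-bsdres` (run/shared/lean/b2b/bsd-rank1-residual/; harvest seat 2, GEN 32,
item E73), where team n1011's typed items (`Summits/BirchSwinnertonDyer/Rank1Residual/X4/KimShaLength.lean`,
`…/Additive/X4RankOneKimPartialShape.lean`, `…/Additive/X4SharpThreeKimLattice*.lean`) carry the
SAME statement as an open per-pair predicate `X4.KimShaLengthAt W p f` (a theorem for `p ≥ 5`, an
announced result for `p ≥ 3` under large image, the cell's own open item at `p = 3`); this file is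
the PUBLISHED `p ≥ 5` case as a Literature fact, so that those predicates are theorems at `p ≥ 5` by
one-line specialisation. HONEST FRAMING of that cell (verbatim): prove what is provable now; shrink
each hard class to its core with data; no claim beyond stated classes.

## Why a further Kim-(6) fact (the siblings and what they do not give)

The tree vendors clause (6) of Kim's theorem in SEVEN shapes already, all corollaries of the one
below read at a particular vanishing order and a particular certificate:
`Kim2022_rankZero_padicValRat_sha_of_kuriharaNumber_ne_zero[_of_maninConstant]`,
`Kim2022_rankOne_card_sha_eq_one_of_kuriharaNumber_ne_zero[_of_maninConstant]`,
`Kim2022_rankOne_padicValNat_sha_le_one_of_kuriharaNumber_levelTwo_ne_zero_of_maninConstant`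
(file `KuriharaNumberKimShaLength`: unit / level-two certificates, `∂^{(∞)} = 0` resp. `∂^{(1)} ≤ 1`),
`Kim2026.rankZero_padicValNat_sha_le_of_maninConstant` (`ShaLengthRankZeroUpperBound`: `∂^{(∞)} ≥ 0`),
`Kim2026.rankZero_le_padicValNat_sha_of_kuriharaNumber_ne_zero` (`ShaLengthRankZeroLowerBound`:
`∂^{(∞)} ≤ k − 1` from one certificate), and
`Kim2026.rankZero_padicValNat_sha_add_le_of_forall_pow_dvd_kuriharaNumber[_cyclicLevel]`
(`ShaLengthRankZeroKuriharaDivisibilityBound`: `∂^{(∞)} ≥ m` from universal divisibility). None of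
them states (6) with BOTH terms `∂^{(ord(δ̃))}` and `∂^{(∞)}` present, and none covers vanishing order
`1` beyond `∂^{(1)} ∈ {0, ≤ 1}`. The cell reached the vanishing-order-`0` node at `p ≥ 5` by
combining the two one-sided facts (`X4/KimShaLengthFiveLe`, `Additive/X4SharpThreeKimLatticeFiveLe`);
the vanishing-order-`1` predicate `Additive.KimRankOnePartialAt` — and the core `X4.KimShaLengthAt` at a
general vanishing order — had NO published antecedent at `p ≥ 5` in the kernel (team n1011,
2026-08-21: p17 INBOX l. 2105 (2); p03 KIM-AT-3-ANATOMY §(η).8 (4): "R3 at `p ≥ 5`: NO theorem … a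
rank-one `∂`-exact fact is not typed").

## The printed statements (C.-H. Kim, *The structure of Selmer groups and the Iwasawa main conjecture
for elliptic curves*, Amer. J. Math. 148 (2026), no. 1, 79–129 = arXiv:2203.12159; held text = arXiv
v4, `paper:arxiv-2203.12159`, whose numbering is used: Thm. 1.9 of v4 = **Thm. 1.8** of the journal
version, statement byte-identical — NUMBERING NOTE of `KuriharaNumberKimStructure`)

* §1.2.2 (PDF p. 5): "`𝒫_k = {ℓ : (ℓ, Np) = 1, ℓ ≡ 1 (mod p^k), a_ℓ(E) ≡ ℓ + 1 (mod p^k)}` … `I_ℓ =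
  (ℓ − 1, a_ℓ − ℓ − 1)ℤ_p`, `I_n = ∑_{ℓ∣n} I_ℓ`"; §1.4.2–1.4.4 (PDF p. 7, p0007 L39–L60): "`δ̃_n =
  ∑_{a ∈ (ℤ/n)ˣ} \overline{[a/n]⁺} ∏_{ℓ∣n} \overline{log_{η_ℓ}(a)} ∈ ℤ_p/I_nℤ_p` … When `n = 1`, we
  have `δ̃_1 = [0]⁺ = L(E,1)/Ω⁺_E`. … The vanishing order of `δ̃` is defined by
  `ord(δ̃) = min{ν(n) : n ∈ 𝒩_1, δ̃_n ≠ 0}`. We write `ord(δ̃) = ∞` if `δ̃_n = 0` for all `n ∈ 𝒩_1`."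
* §1.5.1 (PDF p. 7, p0007 L70–L82): "Denote by `∂^{(0)}(δ̃)` the `p`-adic valuation of `δ̃_1` … For
  `i ∈ ℤ_{>0}`, we also define … `∂^{(i)}(δ̃) = min{j : δ̃_n ∈ p^j ℤ_p/I_nℤ_p for every n ∈ 𝒩_1
  with ν(n) = i} = lim_{k→∞} ∂^{(i)}(δ̃^{(k)})` … We also write
  `∂^{(∞)}(δ̃) = min{∂^{(i)}(δ̃) : 0 ≤ i}`." (read through §2.5.1 / Def. 2.13, PDF pp. 13–14, as the
  LARGEST common `p`-power divisibility of the members with `ν(n) = i` — the reading recorded and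
  justified in `KuriharaNumberInvariants`, whose `kuriharaPartial` / `kuriharaPartialInfty` /
  `kuriharaVanishingOrder` ARE these functionals over the cyclic levels).
* **Theorem 1.9** (PDF pp. 7–8, p0007 L88 – p0008 L12), verbatim: "Let `E` be an elliptic curve
  over `ℚ` and `p ≥ 5` a prime such that `ρ̄` is surjective and the Manin constant is prime to `p`.
  If `ord(δ̃) < ∞`, then (1) `cork_{ℤ_p} Sel(ℚ, E[p^∞]) = ord(δ̃)` … (2) `Fitt_{i,ℤ_p}(Sel(ℚ,E[p^∞])^∨)
  = p^{∂^{(i)}(δ̃) − ∂^{(∞)}(δ̃)} ℤ_p` for all `i ≥ ord(δ̃)` with `i ≡ ord(δ̃) (mod 2)`, and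
  (3) `length_{ℤ_p}(Sel(ℚ, E[p^∞])_{/div}) = ∂^{(ord(δ̃))}(δ̃) − ∂^{(∞)}(δ̃)`. … If we further assume
  the finiteness of `Ш(E/ℚ)[p^∞]`, then we have (4) `rk_ℤ E(ℚ) = ord(δ̃)`, (5) `Ш(E/ℚ)[p^∞] ≃ ⊕_{i≥1}
  (ℤ/p^{(∂^{(ord(δ̃)+2(i−1))}(δ̃) − ∂^{(ord(δ̃)+2i)}(δ̃))/2}ℤ)^{⊕2}`, and so
  **(6) `length_{ℤ_p}(Ш(E/ℚ)[p^∞]) = ∂^{(ord(δ̃))}(δ̃) − ∂^{(∞)}(δ̃)`.**" Proof: "See §5. The first two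
  statements imply all the other statements." NO hypothesis on the reduction of `E` at `p` and NO
  hypothesis on the (analytic) rank enter the statement.
* Thm. 2.14 (PDF p. 14): `∂^{(s)}(κ)` "is finite for `s ≥ ord(κ)`"; hence under `ord(δ̃) < ∞` both
  `∂^{(ord(δ̃))}(δ̃)` and `∂^{(∞)}(δ̃) ≤ ∂^{(ord(δ̃))}(δ̃)` are natural numbers and (6) is an identity
  of natural numbers, `∂^{(ord(δ̃))}(δ̃) = length_{ℤ_p} Ш(E/ℚ)[p^∞] + ∂^{(∞)}(δ̃)` — the
  subtraction-free form stated below (in `ℕ∞`, with `∂^{(∞)}` exhibited as a natural number `d`).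
* §1.3.5 (PDF p. 6): "The Manin constant is not divisible by a prime `p ≥ 3` if `E` has semi-stable
  reduction at `p` [Mazur 1978]. Thus, the Manin constant assumption is needed only when `E` has
  additive reduction at `p`." §1.4.1 (PDF p. 7): the symbols `[r]⁺` are normalised by "the real Néron
  period `Ω⁺_E` … of a global minimal Weierstrass model of `E` over `E(ℝ)`" (= the tree's
  `W.realPeriodRat` for `W` globally minimal).

## The Lean statement and its fidelity (house conventions of every Kim-type fact of the tree)

Binders IDENTICAL to the `_of_maninConstant` siblings of `KuriharaNumberKimShaLength`: `W/ℚ` globally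
minimal elliptic; `p ≥ 5` with `ρ̄_{E,p}` onto (`W.HasSurjectiveModNGaloisRep p`); `Ш(E/ℚ)` finite
(`Finite W.sha` — stronger than the printed "finiteness of `Ш(E/ℚ)[p^∞]`", so the fact is weaker);
Kim's Manin hypothesis carried by a modular parametrisation datum `D` of `W` at a level `N` with
`p ∤ D.maninConstant` (§1.3.5; vacuous at a semi-stable `p`, Mazur 1978 Cor. 4.1); the period
transfer `Ω(W) = u·Ω⁺_{D.f}`, `u ∈ ℚ`, `|u|_p = 1`, which makes the tree's `Ω⁺_f`-normalised Kurihara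
numbers `kuriharaNumber D.f (p^k) n ψ` equal to Kim's `Ω⁺_E`-normalised `δ̃_n^{(k)}` up to a `p`-adic
unit, so that every DIVISIBILITY statement — and hence `ord(δ̃)`, `∂^{(i)}`, `∂^{(∞)}` — is Kim's
(an extra hypothesis: weaker). CONCLUSION: for every `r : ℕ` with `kuriharaVanishingOrder W p D.f = r`
(Kim's "`ord(δ̃) = r < ∞`") there is `d : ℕ` with `kuriharaPartialInfty W p D.f = d` and
`kuriharaPartial W p D.f r = ord_p #Ш(E/ℚ)(p) + d` — clause (6) verbatim in the subtraction-free
form, `#Ш(E/ℚ)(p)` = `Nat.card` of the `p`-primary component of `W.sha` (so `length_{ℤ_p} Ш[p^∞] =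
ord_p #Ш(p)`). This is, symbol for symbol, the body of the cell's predicate `X4.KimShaLengthAt W p D.f`.
LEVELS — flag **`Kim2026-(6)-cyclic-reading`**: `kuriharaVanishingOrder`, `kuriharaPartial`,
`kuriharaPartialInfty` range over the CYCLIC Kolyvagin levels (`IsCyclicKolyvaginLevel`: `n ∈ 𝒩_1`
with `#Ẽ(𝔽_ℓ)[p] ≤ p` at every `ℓ ∣ n`), the levels of the printed PROOF (Kim Thm. 2.1 / §2.2.3,
PDF p. 12: "`T/(Fr_ℓ − 1)T` is a cyclic `ℤ_p`-module for every `ℓ ∈ 𝒫` … Under our working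
hypotheses, all the conditions in Theorem 2.1 below are satisfied"; see the CAVEAT of
`KuriharaNumberKimStructure` and the section docstring "WHY A SECOND FACT" of
`Kim2026.ShaLengthRankZeroKuriharaDivisibilityBound` for why the literal `𝒫_1` of §1.2.2 is too
large for that sentence and why the field — Büyükboduk 2009/2011, Kurihara 2014, Castella–Sano
2026 — reads the prime set this way) — EXACTLY as every Kim-type fact already in the tree and as
the cell's invariants. Relative to the LITERAL display of §1.4.4/§1.5.1 (functionals over all of
`𝒩_1`) the statement below is neither weaker nor stronger (an identity between different infima);
relative to what the source PROVES it is the statement itself, weakened by the period and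
finiteness binders. The residual cell's referee ruled on this reading for the rank-`0` siblings
(REFEREE.md R133.6, 2026-08-21: literal print = statement of record PUB; cyclic-level form admitted
PUB\*, the flag travelling to every consumer); this fact carries the same flag for the same ruling.
Never stronger than what is proved; no reduction hypothesis and no rank hypothesis added or
removed; no `_holds`.

## What is NOT here

Clauses (1)–(3) and (5) (corank, higher Fitting ideals, the elementary-divisor structure); the
`p ≥ 3` large-image extension (Kim, arXiv:2505.09121, ANNOUNCED — typed by the cell as an OPEN
record, `Kim2025/LargeImageStructureOPEN`); the non-vanishing `ord(δ̃) < ∞` itself (Kim's Cor. 1.6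
proves it in analytic rank `≤ 1` at a semi-stable `p` and at a good ordinary `p`; his open statement
1.8 asserts it in general; the cell supplies it per pair as a CERTIFICATE — one non-zero Kurihara
number — which is how every consumer is fed); the BSD-currency reading of `∂^{(0)}`
(`∂^{(0)}(δ̃) = ord_p(L(E,1)/Ω⁺_E)`: the cell's `X4.kimShaLengthRankZeroAt_of_kimShaLengthAt`, and
the siblings above).

## References

* C.-H. Kim, Amer. J. Math. 148 (2026), no. 1, 79–129, doi:10.1353/ajm.2026.a980769 (zbMATH/Crossref
  record checked 2026-08-21) = arXiv:2203.12159v4, Thm. 1.9 (= journal Thm. 1.8)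
  (PDF pp. 7–8), §1.2.2 (p. 5), §1.3.5 (p. 6), §1.4.1–1.4.4 and §1.5.1 (p. 7), Thm. 2.1 / §2.2.3
  (p. 12), §2.5.1 (p. 13), Def. 2.13 and Thm. 2.14 (p. 14). [Kim2022StructureSelmer]
* B. Mazur, Invent. Math. 44 (1978), Cor. 4.1. [Mazur1978]
* B. Mazur, K. Rubin, *Kolyvagin systems*, Mem. Amer. Math. Soc. 168 (2004), no. 799, §5.2 (cited
  through Kim §2). [MazurRubin2004]
-/

noncomputable section

open scoped MatrixGroups ModularForm Classical

open CongruenceSubgroup Literature.NumberTheory.EllipticCurves.ModularForms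
  Literature.NumberTheory.EllipticCurves

namespace Literature.NumberTheory.EllipticCurves.Kim2026

/-- **Kim's structure theorem, clause (6), at EVERY vanishing order — the published `p ≥ 5` core in
`∂`-currency** (C.-H. Kim, Amer. J. Math. 148 (2026), Thm. 1.8 = arXiv:2203.12159v4 **Thm. 1.9 (6)**:
"Let `E` be an elliptic curve over `ℚ` and `p ≥ 5` a prime such that `ρ̄` is surjective and the
Manin constant is prime to `p`. If `ord(δ̃) < ∞`, then … If we further assume the finiteness of
`Ш(E/ℚ)[p^∞]`, then we have … (6) `length_{ℤ_p}(Ш(E/ℚ)[p^∞]) = ∂^{(ord(δ̃))}(δ̃) − ∂^{(∞)}(δ̃)`",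
with Thm. 2.14 "`∂^{(s)}` … is finite for `s ≥ ord`"; see the module docstring for the verbatim
§1.4.4 / §1.5.1 definitions, the locators and the fidelity notes). TRANSCRIPTION: `W/ℚ` globally
minimal elliptic, `p ≥ 5`, `ρ̄_{E,p}` onto, `Ш(E/ℚ)` finite, `D` a modular parametrisation datum of
`W` at level `N` with `p ∤ D.maninConstant`, `Ω(W) = u·Ω⁺_{D.f}` with `|u|_p = 1`; then for every
`r : ℕ` with `ord(δ̃) = r` (`kuriharaVanishingOrder W p D.f = r`) THERE IS `d : ℕ` with
`∂^{(∞)}(δ̃) = d` (`kuriharaPartialInfty W p D.f = d`) and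
`∂^{(r)}(δ̃) = ord_p #Ш(E/ℚ)(p) + d` (`kuriharaPartial W p D.f r = …`, in `ℕ∞`). No reduction
hypothesis at `p`, no rank hypothesis (none in print). Levels: the cyclic Kolyvagin levels of
`KuriharaNumberInvariants` — flag `Kim2026-(6)-cyclic-reading` (the proof-faithful reading of
§1.2.2 via Thm. 2.1; referee ruling R133.6 pattern: PUB\*); period and finiteness binders make it
weaker than what is proved, never stronger. No `_holds` (size XL).
[cite: Kim2022StructureSelmer, Thm. 1.9 (6) (PDF p. 8), Thm. 2.14 (PDF p. 14), §1.4.4 and §1.5.1 (PDF p. 7), §1.2.2 (PDF p. 5), Thm. 2.1 and §2.2.3 (PDF p. 12), §1.3.5 (PDF p. 6), §1.4.1 (PDF p. 7)]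
[cite: Mazur1978, Cor. 4.1] -/
def kuriharaPartial_vanishingOrder_eq_padicValNat_sha_add_partialInfty_of_maninConstant : Prop :=
  ∀ (W : WeierstrassCurve ℚ) [W.IsElliptic] [W.IsGloballyMinimal] (p : ℕ) [Fact p.Prime],
    5 ≤ p → W.HasSurjectiveModNGaloisRep p → Finite W.sha →
    ∀ {N : ℕ} [NeZero N] (D : ModularParametrizationData W N),
    ¬ (p : ℤ) ∣ D.maninConstant →
    (∃ u : ℚ, ‖(u : ℚ_[p])‖ = 1 ∧ W.realPeriodRat = u * plusPeriod D.f) →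
    ∀ r : ℕ, kuriharaVanishingOrder W p D.f = r →
      ∃ d : ℕ, kuriharaPartialInfty W p D.f = d ∧
        kuriharaPartial W p D.f r =
          ((padicValNat p (Nat.card (AddCommGroup.primaryComponent W.sha p)) + d : ℕ) : ℕ∞)

/-! ### The two vanishing orders met in analytic rank `≤ 1`, read off the fact (proved) -/

section Specialisations

variable (W : WeierstrassCurve ℚ) [W.IsElliptic] [W.IsGloballyMinimal] (p : ℕ) [Fact p.Prime]
  (hp : 5 ≤ p) (hsurj : W.HasSurjectiveModNGaloisRep p) (hfin : Finite W.sha)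
  {N : ℕ} [NeZero N] (D : ModularParametrizationData W N) (hc : ¬ (p : ℤ) ∣ D.maninConstant)
  (hu : ∃ u : ℚ, ‖(u : ℚ_[p])‖ = 1 ∧ W.realPeriodRat = u * plusPeriod D.f)

include hp hsurj hfin hc hu

/-- **Clause (6), the inequality it contains**: at the vanishing order `r`,
`ord_p #Ш(E/ℚ)(p) + ∂^{(∞)}(δ̃) ≤ ∂^{(r)}(δ̃)` in `ℕ∞` (an equality by the fact; stated as the upper
bound on `Ш` that the cell's certificate consumers use). [cite: Kim2022StructureSelmer, Thm. 1.9 (6) (PDF p. 8)] -/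
theorem padicValNat_sha_add_partialInfty_le_kuriharaPartial
    (h : kuriharaPartial_vanishingOrder_eq_padicValNat_sha_add_partialInfty_of_maninConstant) {r : ℕ}
    (hr : kuriharaVanishingOrder W p D.f = r) :
    (padicValNat p (Nat.card (AddCommGroup.primaryComponent W.sha p)) : ℕ∞) +
        kuriharaPartialInfty W p D.f ≤ kuriharaPartial W p D.f r := by
  obtain ⟨d, hd, hr'⟩ := h W p hp hsurj hfin D hc hu r hr
  rw [hd, hr', Nat.cast_add]

/-- **Vanishing order `0`** (Kim §1.4.3–1.4.4: `δ̃_1 = [0]⁺ ≠ 0`, i.e. a finite divisibility index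
at the level `1` — in analytic rank `0` this is `L(E,1) ≠ 0`; §1.5.1: "`∂^{(0)}(δ̃)` the `p`-adic
valuation of `δ̃_1`"): there is `d : ℕ` with `∂^{(∞)}(δ̃) = d` and
`ord_p(δ̃_1) = ord_p #Ш(E/ℚ)(p) + d`, the index read on `kuriharaDivIndex W p D.f 1`
(`kuriharaPartial_zero`). The shape behind the rank-`0` siblings (`…_of_maninConstant`, A161, the
two directions of `ShaLengthRankZero{Lower,KuriharaDivisibility}Bound`) and behind the cell's
`X4.KimShaLengthRankZeroAt`. [cite: Kim2022StructureSelmer, Thm. 1.9 (6) (PDF p. 8), §1.4.3–1.4.4 and §1.5.1 (PDF p. 7)] -/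
theorem exists_partialInfty_eq_and_kuriharaDivIndex_one_eq_of_lt_top
    (h : kuriharaPartial_vanishingOrder_eq_padicValNat_sha_add_partialInfty_of_maninConstant)
    (h1 : kuriharaDivIndex W p D.f 1 < ⊤) :
    ∃ d : ℕ, kuriharaPartialInfty W p D.f = d ∧
      kuriharaDivIndex W p D.f 1 =
        ((padicValNat p (Nat.card (AddCommGroup.primaryComponent W.sha p)) + d : ℕ) : ℕ∞) := by
  obtain ⟨d, hd, h0⟩ := h W p hp hsurj hfin D hc hu 0 (kuriharaVanishingOrder_eq_zero_of W p D.f h1)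
  exact ⟨d, hd, by rw [← kuriharaPartial_zero, h0]⟩

/-- **Vanishing order `1`** (in analytic rank `1`: `δ̃_1 = L(E,1)/Ω⁺_E = 0` and some prime-level
Kurihara number is non-zero, so `ord(δ̃) = 1`): `ord_p #Ш(E/ℚ)(p) + ∂^{(∞)}(δ̃) = ∂^{(1)}(δ̃)` in
`ℕ∞` — the consequent of the cell's per-pair predicate `Additive.KimRankOnePartialAt W p`, of which
the two rank-one siblings of `KuriharaNumberKimShaLength` (unit certificate: `∂^{(1)} = 0`;
level-two certificate: `∂^{(1)} ≤ 1`) are the readings at `∂^{(1)} ∈ {0, ≤ 1}`.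
[cite: Kim2022StructureSelmer, Thm. 1.9 (1), (4) and (6) (PDF pp. 7–8), §1.4.4 and §1.5.1 (PDF p. 7)] -/
theorem padicValNat_sha_add_partialInfty_eq_kuriharaPartial_one
    (h : kuriharaPartial_vanishingOrder_eq_padicValNat_sha_add_partialInfty_of_maninConstant)
    (hr : kuriharaVanishingOrder W p D.f = 1) :
    (padicValNat p (Nat.card (AddCommGroup.primaryComponent W.sha p)) : ℕ∞) +
        kuriharaPartialInfty W p D.f = kuriharaPartial W p D.f 1 := by
  obtain ⟨d, hd, h1⟩ := h W p hp hsurj hfin D hc hu 1 hr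
  rw [hd, h1, Nat.cast_add]

/-- **Vanishing order `1`, the bare upper bound**: `ord_p #Ш(E/ℚ)(p) ≤ ∂^{(1)}(δ̃)` (drop
`∂^{(∞)} ≥ 0`); with ONE Kurihara number non-zero modulo `p^k` at a cyclic Kolyvagin prime of
level `k` (`∂^{(1)} ≤ k − 1`) this is `ord_p #Ш(E/ℚ)(p) ≤ k − 1` — the general-level form of the
unit (`k = 1`) and level-two (`k = 2`) siblings. [cite: Kim2022StructureSelmer, Thm. 1.9 (6) (PDF p. 8), §1.5.1 (PDF p. 7)] -/
theorem padicValNat_sha_le_kuriharaPartial_one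
    (h : kuriharaPartial_vanishingOrder_eq_padicValNat_sha_add_partialInfty_of_maninConstant)
    (hr : kuriharaVanishingOrder W p D.f = 1) :
    (padicValNat p (Nat.card (AddCommGroup.primaryComponent W.sha p)) : ℕ∞) ≤
      kuriharaPartial W p D.f 1 :=
  le_self_add.trans (padicValNat_sha_add_partialInfty_eq_kuriharaPartial_one W p hp hsurj hfin D hc
    hu h hr).le

end Specialisations

end Literature.NumberTheory.EllipticCurves.Kim2026

end
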